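import Summits.ValiantsHypothesis.ValiantsHypothesis.Theorems.LacunarySymmetroidMatrixDescartesPivotResolventRolle
import Summits.ValiantsHypothesis.ValiantsHypothesis.Theorems.LacunarySymmetroidMatrixDescartesPivotRankOneNeedleIdentity

/-!
# `MatrixDescartes` census — rank-one `(2,4)₁`: the RESOLVENT of the four-letter pencil and the PAIR-FORM IDENTITY
# (`Z₊(det F) ≤ 1 + Z₊(Φ)` instantiated; `Φ = W² + (τ² + 4δπ)·P_e`, so critical points of the profile live in `{P_e < 0}`)

HONEST FRAMING.  Object-search cell `pub-symmetroid`, seat `val-sym-mdr-p1` (generation 18); helper file `--supports` the crux item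
stmt-ValiantsHypothesis-18050 (`Theses.LacunarySymmetroid.MatrixDescartes`, OPEN, on HOLD) with NO closure claim.  Companion of
`…PivotResolventRolle` (the abstract RESOLVENT ROLLE BOUND).  For the rank-one pencil `F = X^e J + ∑ₖ wₖ X^{dₖ} vₖvₖᵀ` (`J` real symmetric,
`δ := J₀₁² − J₀₀J₁₁ = −det J`, four letters) write `A, U, C` for the entries of the letter sum `G = ∑ₖ wₖ x^{dₖ} vₖvₖᵀ` and `A_e, U_e, C_e` for
those of the e-TILTED DERIVATIVE `G_e = x G′ − e G = ∑ₖ (dₖ − e) wₖ x^{dₖ} vₖvₖᵀ`.  Then (§2) `det F(x) = −δx^{2e} + x^e τ(x) + π(x)` with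
`τ = J₀₀C − 2J₀₁U + J₁₁A = tr(adj J·G)`, `π = AC − U² = det G = ∑_{k<l} wₖw_l D_{kl}² x^{dₖ+d_l}` (`D_{kl} = det[vₖ, v_l]`), and the
critical polynomial of `…PivotResolventRolle` satisfies the **PAIR-FORM IDENTITY** (§1, pure `2 × 2` algebra)
`Φ := δπ_e² + ττ_eπ_e − πτ_e² = W² + (τ² + 4δπ)·P_e`, where `P_e = det G_e = A_eC_e − U_e² = ∑_{k<l} (dₖ − e)(d_l − e) wₖw_l D_{kl}² x^{dₖ+d_l}`
is the e-SIGNED PAIR FORM and `W = J₀₀(U_eC − UC_e) − J₀₁(A_eC − AC_e) + J₁₁(A_eU − AU_e)` an e-free Wronskian.  CONSEQUENCES: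
**`Z₊(det F) ≤ 1 + Z₊(Φ)`** for every position of the pivot (`rankOne_four_card_posRoots_le_one_add`, from the Rolle bound), and at every
positive root of `Φ` — in particular at every critical point of the resolvent profile `R(x)/x^e` — **`P_e ≤ 0`** (`pairForm_nonpos_of_isRoot`):
the profile can only turn where the cross pairs `(k, l)` with `dₖ < e < d_l` outweigh the one-sided pairs in the e-signed pair sum.  On the
`1|3` split (`d₀ < e < d₁ < d₂ < d₃`) with `d₀ + d₃ ≤ d₁ + d₂` — chamber (C) of `…PivotRankOneReductionOneThree` included — `P_e` has ONE sign
change (companion `…PivotRankOneResolventConfinement`: `P_e/x^{d₀+d₃}` is nondecreasing), so all turning points of the profile precede the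
first point where `P_e` is positive (the window count itself stays OPEN).
Nothing here bears on `MatrixDescartes` in its window, on `DoorA26` / `DoorA34`, registers / credences, or `VP ≠ VNP`; rank-one register
`{8, 9}` unchanged.

[folklore] `2 × 2` determinant algebra (Lagrange's identity), the tree's `eval_det_rankOne_four` and `x_mul_eval_derivative_C_mul_X_pow`,
`Polynomial.funext`.  No definitions, no named facts.
-/

-- `Summit.ValiantsHypothesis.ValiantsHypothesis.…` repeats a component by the D-0017 layout
-- (single-conjunct summit), which the `dupNamespace` linter flags; the name is mandated.
set_option linter.dupNamespace false

namespace Summit.ValiantsHypothesis.ValiantsHypothesis.Theorems.LacunarySymmetroidMatrixDescartes.Pivot.Resolvent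

open Polynomial Matrix Finset Set
open scoped BigOperators
open Summit.ValiantsHypothesis.ValiantsHypothesis.Theorems.LacunarySymmetroidMatrixDescartes.Pivot.NullDirection
  (eval_det_rankOne_four x_mul_eval_derivative_C_mul_X_pow)

/-! ## 1. `2 × 2` algebra: the pair-form identity in the six moments `A, U, C, A_e, U_e, C_e` -/

/-- **PAIR-FORM IDENTITY (abstract).**  For arbitrary reals `A, U, C, A_e, U_e, C_e` and a symmetric `J = [[J₀₀, J₀₁], [J₀₁, J₁₁]]`, with
`δ = J₀₁² − J₀₀J₁₁`, `τ = J₀₀C − 2J₀₁U + J₁₁A`, `τ_e = J₀₀C_e − 2J₀₁U_e + J₁₁A_e`, `π = AC − U²`, `π_e = A_eC + AC_e − 2UU_e`: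
`δπ_e² + ττ_eπ_e − πτ_e² = W² + (τ² + 4δπ)(A_eC_e − U_e²)`, `W = J₀₀(U_eC − UC_e) − J₀₁(A_eC − AC_e) + J₁₁(A_eU − AU_e)`. [folklore: `ring`] -/
theorem pairForm_identity (A U C Ae Ue Ce J₀₀ J₀₁ J₁₁ : ℝ) :
    (J₀₁ ^ 2 - J₀₀ * J₁₁) * (Ae * C + A * Ce - 2 * U * Ue) ^ 2
      + (J₀₀ * C - 2 * J₀₁ * U + J₁₁ * A) * (J₀₀ * Ce - 2 * J₀₁ * Ue + J₁₁ * Ae) * (Ae * C + A * Ce - 2 * U * Ue)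
      - (A * C - U ^ 2) * (J₀₀ * Ce - 2 * J₀₁ * Ue + J₁₁ * Ae) ^ 2
    = (J₀₀ * (Ue * C - U * Ce) - J₀₁ * (Ae * C - A * Ce) + J₁₁ * (Ae * U - A * Ue)) ^ 2
      + ((J₀₀ * C - 2 * J₀₁ * U + J₁₁ * A) ^ 2 + 4 * (J₀₁ ^ 2 - J₀₀ * J₁₁) * (A * C - U ^ 2)) * (Ae * Ce - Ue ^ 2) := by
  ring

/-- Consequence: where the critical polynomial vanishes and the resolvent discriminant `τ² + 4δπ` is positive, the pair form `A_eC_e − U_e²`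
is `≤ 0`, and `< 0` unless `W = 0`. [this file] -/
theorem pairForm_nonpos_of_zero (A U C Ae Ue Ce J₀₀ J₀₁ J₁₁ : ℝ)
    (hdisc : 0 < (J₀₀ * C - 2 * J₀₁ * U + J₁₁ * A) ^ 2 + 4 * (J₀₁ ^ 2 - J₀₀ * J₁₁) * (A * C - U ^ 2))
    (hΦ : (J₀₁ ^ 2 - J₀₀ * J₁₁) * (Ae * C + A * Ce - 2 * U * Ue) ^ 2
      + (J₀₀ * C - 2 * J₀₁ * U + J₁₁ * A) * (J₀₀ * Ce - 2 * J₀₁ * Ue + J₁₁ * Ae) * (Ae * C + A * Ce - 2 * U * Ue)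
      - (A * C - U ^ 2) * (J₀₀ * Ce - 2 * J₀₁ * Ue + J₁₁ * Ae) ^ 2 = 0) :
    Ae * Ce - Ue ^ 2 ≤ 0
    ∧ (J₀₀ * (Ue * C - U * Ce) - J₀₁ * (Ae * C - A * Ce) + J₁₁ * (Ae * U - A * Ue) ≠ 0 → Ae * Ce - Ue ^ 2 < 0) := by
  rw [pairForm_identity] at hΦ
  set W := J₀₀ * (Ue * C - U * Ce) - J₀₁ * (Ae * C - A * Ce) + J₁₁ * (Ae * U - A * Ue)
  set S2 := (J₀₀ * C - 2 * J₀₁ * U + J₁₁ * A) ^ 2 + 4 * (J₀₁ ^ 2 - J₀₀ * J₁₁) * (A * C - U ^ 2)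
  have hP : Ae * Ce - Ue ^ 2 = -(W ^ 2) / S2 := by
    field_simp
    linear_combination hΦ
  refine ⟨?_, fun hW => ?_⟩
  · rw [hP]; exact div_nonpos_of_nonpos_of_nonneg (neg_nonpos.2 (sq_nonneg W)) hdisc.le
  · have hW2 : 0 < W ^ 2 := by positivity
    rw [hP]; exact div_neg_of_neg_of_pos (neg_neg_of_pos hW2) hdisc

/-! ## 2. The four-letter pencil: moments, resolvent form, pair sums -/

/-- `x·d/dx` of a four-nomial `∑ₖ cₖ X^{dₖ}`, evaluated: `x·(∑ₖ cₖX^{dₖ})′(x) = ∑ₖ dₖcₖx^{dₖ}`. [tree: `x_mul_eval_derivative_C_mul_X_pow`] -/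
theorem x_mul_eval_derivative_fourNomial (c₀ c₁ c₂ c₃ x : ℝ) (d₀ d₁ d₂ d₃ : ℕ) :
    x * (Polynomial.derivative (Polynomial.C c₀ * X ^ d₀ + Polynomial.C c₁ * X ^ d₁ + Polynomial.C c₂ * X ^ d₂
        + Polynomial.C c₃ * X ^ d₃)).eval x
      = (d₀ : ℝ) * c₀ * x ^ d₀ + (d₁ : ℝ) * c₁ * x ^ d₁ + (d₂ : ℝ) * c₂ * x ^ d₂ + (d₃ : ℝ) * c₃ * x ^ d₃ := by
  simp only [derivative_add, eval_add, mul_add]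
  rw [x_mul_eval_derivative_C_mul_X_pow, x_mul_eval_derivative_C_mul_X_pow, x_mul_eval_derivative_C_mul_X_pow,
    x_mul_eval_derivative_C_mul_X_pow]

/-- Evaluation of a four-nomial. [folklore] -/
theorem eval_fourNomial (c₀ c₁ c₂ c₃ x : ℝ) (d₀ d₁ d₂ d₃ : ℕ) :
    (Polynomial.C c₀ * X ^ d₀ + Polynomial.C c₁ * X ^ d₁ + Polynomial.C c₂ * X ^ d₂ + Polynomial.C c₃ * X ^ d₃).eval x
      = c₀ * x ^ d₀ + c₁ * x ^ d₁ + c₂ * x ^ d₂ + c₃ * x ^ d₃ := by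
  simp only [eval_add, eval_mul, eval_C, eval_pow, eval_X]

/-- **Lagrange's identity for four letters**: `AC − U² = ∑_{k<l} wₖw_l D_{kl}² x^{dₖ+d_l}` with `D_{kl} = vₖ₀v_{l1} − vₖ₁v_{l0}`, for the
moments `A = ∑ wₖx^{dₖ}vₖ₀²`, `U = ∑ wₖx^{dₖ}vₖ₀vₖ₁`, `C = ∑ wₖx^{dₖ}vₖ₁²` (any real weights). [folklore] -/
theorem pairDet_eq (d₀ d₁ d₂ d₃ : ℕ) (v₀ v₁ v₂ v₃ : Fin 2 → ℝ) (w₀ w₁ w₂ w₃ x : ℝ) :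
    (w₀ * x ^ d₀ * v₀ 0 ^ 2 + w₁ * x ^ d₁ * v₁ 0 ^ 2 + w₂ * x ^ d₂ * v₂ 0 ^ 2 + w₃ * x ^ d₃ * v₃ 0 ^ 2)
        * (w₀ * x ^ d₀ * v₀ 1 ^ 2 + w₁ * x ^ d₁ * v₁ 1 ^ 2 + w₂ * x ^ d₂ * v₂ 1 ^ 2 + w₃ * x ^ d₃ * v₃ 1 ^ 2)
      - (w₀ * x ^ d₀ * (v₀ 0 * v₀ 1) + w₁ * x ^ d₁ * (v₁ 0 * v₁ 1) + w₂ * x ^ d₂ * (v₂ 0 * v₂ 1) + w₃ * x ^ d₃ * (v₃ 0 * v₃ 1)) ^ 2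
    = w₀ * w₁ * (v₀ 0 * v₁ 1 - v₀ 1 * v₁ 0) ^ 2 * x ^ (d₀ + d₁) + w₀ * w₂ * (v₀ 0 * v₂ 1 - v₀ 1 * v₂ 0) ^ 2 * x ^ (d₀ + d₂)
      + w₀ * w₃ * (v₀ 0 * v₃ 1 - v₀ 1 * v₃ 0) ^ 2 * x ^ (d₀ + d₃) + w₁ * w₂ * (v₁ 0 * v₂ 1 - v₁ 1 * v₂ 0) ^ 2 * x ^ (d₁ + d₂)
      + w₁ * w₃ * (v₁ 0 * v₃ 1 - v₁ 1 * v₃ 0) ^ 2 * x ^ (d₁ + d₃) + w₂ * w₃ * (v₂ 0 * v₃ 1 - v₂ 1 * v₃ 0) ^ 2 * x ^ (d₂ + d₃) := by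
  ring

/-- The same identity for the e-tilted moments (weights `(dₖ − e)wₖ`): the **e-SIGNED PAIR FORM**
`P_e := A_eC_e − U_e² = ∑_{k<l} (dₖ − e)(d_l − e) wₖw_l D_{kl}² x^{dₖ+d_l}`. [folklore] -/
theorem pairForm_eq (e : ℝ) (d₀ d₁ d₂ d₃ : ℕ) (v₀ v₁ v₂ v₃ : Fin 2 → ℝ) (w₀ w₁ w₂ w₃ x : ℝ) :
    (((d₀ : ℝ) - e) * w₀ * x ^ d₀ * v₀ 0 ^ 2 + ((d₁ : ℝ) - e) * w₁ * x ^ d₁ * v₁ 0 ^ 2 + ((d₂ : ℝ) - e) * w₂ * x ^ d₂ * v₂ 0 ^ 2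
          + ((d₃ : ℝ) - e) * w₃ * x ^ d₃ * v₃ 0 ^ 2)
        * (((d₀ : ℝ) - e) * w₀ * x ^ d₀ * v₀ 1 ^ 2 + ((d₁ : ℝ) - e) * w₁ * x ^ d₁ * v₁ 1 ^ 2 + ((d₂ : ℝ) - e) * w₂ * x ^ d₂ * v₂ 1 ^ 2
          + ((d₃ : ℝ) - e) * w₃ * x ^ d₃ * v₃ 1 ^ 2)
      - (((d₀ : ℝ) - e) * w₀ * x ^ d₀ * (v₀ 0 * v₀ 1) + ((d₁ : ℝ) - e) * w₁ * x ^ d₁ * (v₁ 0 * v₁ 1)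
          + ((d₂ : ℝ) - e) * w₂ * x ^ d₂ * (v₂ 0 * v₂ 1) + ((d₃ : ℝ) - e) * w₃ * x ^ d₃ * (v₃ 0 * v₃ 1)) ^ 2
    = ((d₀ : ℝ) - e) * ((d₁ : ℝ) - e) * w₀ * w₁ * (v₀ 0 * v₁ 1 - v₀ 1 * v₁ 0) ^ 2 * x ^ (d₀ + d₁)
      + ((d₀ : ℝ) - e) * ((d₂ : ℝ) - e) * w₀ * w₂ * (v₀ 0 * v₂ 1 - v₀ 1 * v₂ 0) ^ 2 * x ^ (d₀ + d₂)
      + ((d₀ : ℝ) - e) * ((d₃ : ℝ) - e) * w₀ * w₃ * (v₀ 0 * v₃ 1 - v₀ 1 * v₃ 0) ^ 2 * x ^ (d₀ + d₃)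
      + ((d₁ : ℝ) - e) * ((d₂ : ℝ) - e) * w₁ * w₂ * (v₁ 0 * v₂ 1 - v₁ 1 * v₂ 0) ^ 2 * x ^ (d₁ + d₂)
      + ((d₁ : ℝ) - e) * ((d₃ : ℝ) - e) * w₁ * w₃ * (v₁ 0 * v₃ 1 - v₁ 1 * v₃ 0) ^ 2 * x ^ (d₁ + d₃)
      + ((d₂ : ℝ) - e) * ((d₃ : ℝ) - e) * w₂ * w₃ * (v₂ 0 * v₃ 1 - v₂ 1 * v₃ 0) ^ 2 * x ^ (d₂ + d₃) := by
  ring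

/-- Non-negativity of `π = det G` at `x > 0` for non-negative weights. [folklore] -/
theorem pairDet_nonneg (d₀ d₁ d₂ d₃ : ℕ) (v₀ v₁ v₂ v₃ : Fin 2 → ℝ) (w₀ w₁ w₂ w₃ x : ℝ) (hw₀ : 0 ≤ w₀) (hw₁ : 0 ≤ w₁)
    (hw₂ : 0 ≤ w₂) (hw₃ : 0 ≤ w₃) (hx : 0 < x) :
    0 ≤ (w₀ * x ^ d₀ * v₀ 0 ^ 2 + w₁ * x ^ d₁ * v₁ 0 ^ 2 + w₂ * x ^ d₂ * v₂ 0 ^ 2 + w₃ * x ^ d₃ * v₃ 0 ^ 2)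
        * (w₀ * x ^ d₀ * v₀ 1 ^ 2 + w₁ * x ^ d₁ * v₁ 1 ^ 2 + w₂ * x ^ d₂ * v₂ 1 ^ 2 + w₃ * x ^ d₃ * v₃ 1 ^ 2)
      - (w₀ * x ^ d₀ * (v₀ 0 * v₀ 1) + w₁ * x ^ d₁ * (v₁ 0 * v₁ 1) + w₂ * x ^ d₂ * (v₂ 0 * v₂ 1) + w₃ * x ^ d₃ * (v₃ 0 * v₃ 1)) ^ 2 := by
  rw [pairDet_eq]
  positivity

/-- **The four-letter determinant in resolvent form.**  For `J` symmetric, at every real `x`: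
`det F(x) = −δ·(x^e)² + τ(x)·x^e + π(x)` with `δ = J₀₁² − J₀₀J₁₁`, `τ = J₀₀C − 2J₀₁U + J₁₁A`, `π = AC − U²`. [tree `eval_det_rankOne_four` + `ring`] -/
theorem eval_det_resolvent_form (e d₀ d₁ d₂ d₃ : ℕ) (J : Matrix (Fin 2) (Fin 2) ℝ) (hJ : J 1 0 = J 0 1) (v₀ v₁ v₂ v₃ : Fin 2 → ℝ)
    (w₀ w₁ w₂ w₃ x : ℝ) :
    (Matrix.det (((X : ℝ[X]) ^ e) • J.map Polynomial.C
        + (Polynomial.C w₀ * X ^ d₀) • (vecMulVec v₀ v₀).map Polynomial.C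
        + (Polynomial.C w₁ * X ^ d₁) • (vecMulVec v₁ v₁).map Polynomial.C
        + (Polynomial.C w₂ * X ^ d₂) • (vecMulVec v₂ v₂).map Polynomial.C
        + (Polynomial.C w₃ * X ^ d₃) • (vecMulVec v₃ v₃).map Polynomial.C)).eval x
      = -(J 0 1 ^ 2 - J 0 0 * J 1 1) * (x ^ e) ^ 2
        + (J 0 0 * (w₀ * x ^ d₀ * v₀ 1 ^ 2 + w₁ * x ^ d₁ * v₁ 1 ^ 2 + w₂ * x ^ d₂ * v₂ 1 ^ 2 + w₃ * x ^ d₃ * v₃ 1 ^ 2)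
            - 2 * J 0 1 * (w₀ * x ^ d₀ * (v₀ 0 * v₀ 1) + w₁ * x ^ d₁ * (v₁ 0 * v₁ 1) + w₂ * x ^ d₂ * (v₂ 0 * v₂ 1)
                + w₃ * x ^ d₃ * (v₃ 0 * v₃ 1))
            + J 1 1 * (w₀ * x ^ d₀ * v₀ 0 ^ 2 + w₁ * x ^ d₁ * v₁ 0 ^ 2 + w₂ * x ^ d₂ * v₂ 0 ^ 2 + w₃ * x ^ d₃ * v₃ 0 ^ 2)) * x ^ e
        + ((w₀ * x ^ d₀ * v₀ 0 ^ 2 + w₁ * x ^ d₁ * v₁ 0 ^ 2 + w₂ * x ^ d₂ * v₂ 0 ^ 2 + w₃ * x ^ d₃ * v₃ 0 ^ 2)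
            * (w₀ * x ^ d₀ * v₀ 1 ^ 2 + w₁ * x ^ d₁ * v₁ 1 ^ 2 + w₂ * x ^ d₂ * v₂ 1 ^ 2 + w₃ * x ^ d₃ * v₃ 1 ^ 2)
          - (w₀ * x ^ d₀ * (v₀ 0 * v₀ 1) + w₁ * x ^ d₁ * (v₁ 0 * v₁ 1) + w₂ * x ^ d₂ * (v₂ 0 * v₂ 1)
              + w₃ * x ^ d₃ * (v₃ 0 * v₃ 1)) ^ 2) := by
  rw [eval_det_rankOne_four e d₀ d₁ d₂ d₃ J hJ]
  ring

/-! ## 3. The critical polynomial `Φ`: abstract evaluation, the four-letter instantiation, the pair-form identity -/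

/-- **Evaluation of the critical polynomial (any moment polynomials).**  For ARBITRARY `𝔄, 𝔘, ℭ ∈ ℝ[X]`, `τ = J₀₀ℭ − 2J₀₁𝔘 + J₁₁𝔄`,
`π = 𝔄ℭ − 𝔘²` and the critical polynomial `Φ` of `…PivotResolventRolle`, at every real `x`:
`Φ(x) = W² + (τ(x)² + 4δπ(x))·(A_eC_e − U_e²)` with `A = 𝔄(x)`, `A_e = x𝔄′(x) − e𝔄(x)` (etc.) and `W` as in `pairForm_identity`.
[this file: evaluation + `pairForm_identity`] -/
theorem eval_criticalPoly_eq (e : ℕ) (J : Matrix (Fin 2) (Fin 2) ℝ) (𝔄 𝔘 ℭ τ π Φ : ℝ[X])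
    (hτ : τ = Polynomial.C (J 0 0) * ℭ - Polynomial.C (2 * J 0 1) * 𝔘 + Polynomial.C (J 1 1) * 𝔄)
    (hπ : π = 𝔄 * ℭ - 𝔘 ^ 2)
    (hΦ : Φ = Polynomial.C (J 0 1 ^ 2 - J 0 0 * J 1 1) * (X * π.derivative - Polynomial.C (2 * (e : ℝ)) * π) ^ 2
        + τ * (X * τ.derivative - Polynomial.C (e : ℝ) * τ) * (X * π.derivative - Polynomial.C (2 * (e : ℝ)) * π)
        - π * (X * τ.derivative - Polynomial.C (e : ℝ) * τ) ^ 2) (x : ℝ) :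
    Φ.eval x
      = (J 0 0 * ((x * 𝔘.derivative.eval x - e * 𝔘.eval x) * ℭ.eval x - 𝔘.eval x * (x * ℭ.derivative.eval x - e * ℭ.eval x))
          - J 0 1 * ((x * 𝔄.derivative.eval x - e * 𝔄.eval x) * ℭ.eval x - 𝔄.eval x * (x * ℭ.derivative.eval x - e * ℭ.eval x))
          + J 1 1 * ((x * 𝔄.derivative.eval x - e * 𝔄.eval x) * 𝔘.eval x - 𝔄.eval x * (x * 𝔘.derivative.eval x - e * 𝔘.eval x))) ^ 2
        + ((τ.eval x) ^ 2 + 4 * (J 0 1 ^ 2 - J 0 0 * J 1 1) * π.eval x)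
          * ((x * 𝔄.derivative.eval x - e * 𝔄.eval x) * (x * ℭ.derivative.eval x - e * ℭ.eval x)
            - (x * 𝔘.derivative.eval x - e * 𝔘.eval x) ^ 2) := by
  subst hΦ
  subst hτ
  subst hπ
  simp only [eval_add, eval_sub, eval_mul, eval_pow, eval_C, eval_X, derivative_add, derivative_sub, derivative_mul, derivative_C,
    derivative_pow, zero_mul, zero_add, Nat.cast_ofNat, Nat.add_one_sub_one, pow_one]
  ring

/-- **`Z₊(det F) ≤ 1 + Z₊(Φ)` for the four-letter rank-one pencil** — the RESOLVENT ROLLE BOUND of `…PivotResolventRolle` instantiated with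
the moment polynomials `𝔄 = ∑ C(wₖvₖ₀²)X^{dₖ}`, `𝔘 = ∑ C(wₖvₖ₀vₖ₁)X^{dₖ}`, `ℭ = ∑ C(wₖvₖ₁²)X^{dₖ}`, `τ = J₀₀ℭ − 2J₀₁𝔘 + J₁₁𝔄`,
`π = 𝔄ℭ − 𝔘²`, any position of the pivot exponent `e`.  Hypotheses: `J` symmetric with `det J < 0`, weights `≥ 0`, the resolvent
discriminant `τ² + 4δπ` positive on `(0, ∞)` (e.g. two non-parallel letters with positive weights), `Φ ≠ 0`. [this file + `…PivotResolventRolle`] -/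
theorem rankOne_four_card_posRoots_le_one_add (e d₀ d₁ d₂ d₃ : ℕ) (J : Matrix (Fin 2) (Fin 2) ℝ) (hJ : J 1 0 = J 0 1)
    (hdJ : J 0 0 * J 1 1 - J 0 1 ^ 2 < 0) (v₀ v₁ v₂ v₃ : Fin 2 → ℝ) (w₀ w₁ w₂ w₃ : ℝ) (hw₀ : 0 ≤ w₀) (hw₁ : 0 ≤ w₁) (hw₂ : 0 ≤ w₂)
    (hw₃ : 0 ≤ w₃)
    (𝔄 𝔘 ℭ τ π Φ : ℝ[X])
    (h𝔄 : 𝔄 = Polynomial.C (w₀ * v₀ 0 ^ 2) * X ^ d₀ + Polynomial.C (w₁ * v₁ 0 ^ 2) * X ^ d₁ + Polynomial.C (w₂ * v₂ 0 ^ 2) * X ^ d₂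
      + Polynomial.C (w₃ * v₃ 0 ^ 2) * X ^ d₃)
    (h𝔘 : 𝔘 = Polynomial.C (w₀ * (v₀ 0 * v₀ 1)) * X ^ d₀ + Polynomial.C (w₁ * (v₁ 0 * v₁ 1)) * X ^ d₁
      + Polynomial.C (w₂ * (v₂ 0 * v₂ 1)) * X ^ d₂ + Polynomial.C (w₃ * (v₃ 0 * v₃ 1)) * X ^ d₃)
    (hℭ : ℭ = Polynomial.C (w₀ * v₀ 1 ^ 2) * X ^ d₀ + Polynomial.C (w₁ * v₁ 1 ^ 2) * X ^ d₁ + Polynomial.C (w₂ * v₂ 1 ^ 2) * X ^ d₂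
      + Polynomial.C (w₃ * v₃ 1 ^ 2) * X ^ d₃)
    (hτ : τ = Polynomial.C (J 0 0) * ℭ - Polynomial.C (2 * J 0 1) * 𝔘 + Polynomial.C (J 1 1) * 𝔄)
    (hπ : π = 𝔄 * ℭ - 𝔘 ^ 2)
    (hΦ : Φ = Polynomial.C (J 0 1 ^ 2 - J 0 0 * J 1 1) * (X * π.derivative - Polynomial.C (2 * (e : ℝ)) * π) ^ 2
        + τ * (X * τ.derivative - Polynomial.C (e : ℝ) * τ) * (X * π.derivative - Polynomial.C (2 * (e : ℝ)) * π)
        - π * (X * τ.derivative - Polynomial.C (e : ℝ) * τ) ^ 2)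
    (hdisc : ∀ x, 0 < x → 0 < (τ.eval x) ^ 2 + 4 * (J 0 1 ^ 2 - J 0 0 * J 1 1) * π.eval x) (hΦ0 : Φ ≠ 0) :
    ((Matrix.det (((X : ℝ[X]) ^ e) • J.map Polynomial.C
        + (Polynomial.C w₀ * X ^ d₀) • (vecMulVec v₀ v₀).map Polynomial.C
        + (Polynomial.C w₁ * X ^ d₁) • (vecMulVec v₁ v₁).map Polynomial.C
        + (Polynomial.C w₂ * X ^ d₂) • (vecMulVec v₂ v₂).map Polynomial.C
        + (Polynomial.C w₃ * X ^ d₃) • (vecMulVec v₃ v₃).map Polynomial.C)).roots.toFinset.filter (fun t => 0 < t)).card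
      ≤ (Φ.roots.toFinset.filter (fun t => 0 < t)).card + 1 := by
  have hπeval : ∀ x, π.eval x = (w₀ * x ^ d₀ * v₀ 0 ^ 2 + w₁ * x ^ d₁ * v₁ 0 ^ 2 + w₂ * x ^ d₂ * v₂ 0 ^ 2 + w₃ * x ^ d₃ * v₃ 0 ^ 2) * (w₀ * x ^ d₀ * v₀ 1 ^ 2 + w₁ * x ^ d₁ * v₁ 1 ^ 2 + w₂ * x ^ d₂ * v₂ 1 ^ 2 + w₃ * x ^ d₃ * v₃ 1 ^ 2) - (w₀ * x ^ d₀ * (v₀ 0 * v₀ 1) + w₁ * x ^ d₁ * (v₁ 0 * v₁ 1) + w₂ * x ^ d₂ * (v₂ 0 * v₂ 1) + w₃ * x ^ d₃ * (v₃ 0 * v₃ 1)) ^ 2 := by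
    intro x
    rw [hπ, eval_sub, eval_mul, eval_pow, h𝔄, h𝔘, hℭ, eval_fourNomial, eval_fourNomial, eval_fourNomial]
    ring
  have hτeval : ∀ x, τ.eval x = J 0 0 * (w₀ * x ^ d₀ * v₀ 1 ^ 2 + w₁ * x ^ d₁ * v₁ 1 ^ 2 + w₂ * x ^ d₂ * v₂ 1 ^ 2 + w₃ * x ^ d₃ * v₃ 1 ^ 2) - 2 * J 0 1 * (w₀ * x ^ d₀ * (v₀ 0 * v₀ 1) + w₁ * x ^ d₁ * (v₁ 0 * v₁ 1) + w₂ * x ^ d₂ * (v₂ 0 * v₂ 1) + w₃ * x ^ d₃ * (v₃ 0 * v₃ 1)) + J 1 1 * (w₀ * x ^ d₀ * v₀ 0 ^ 2 + w₁ * x ^ d₁ * v₁ 0 ^ 2 + w₂ * x ^ d₂ * v₂ 0 ^ 2 + w₃ * x ^ d₃ * v₃ 0 ^ 2) := by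
    intro x
    rw [hτ]
    simp only [eval_add, eval_sub, eval_mul, eval_C]
    rw [h𝔄, h𝔘, hℭ, eval_fourNomial, eval_fourNomial, eval_fourNomial]
    ring
  have hmain := card_posRoots_le_one_add_of_resolvent (J 0 1 ^ 2 - J 0 0 * J 1 1) e τ π
    (Matrix.det (((X : ℝ[X]) ^ e) • J.map Polynomial.C
        + (Polynomial.C w₀ * X ^ d₀) • (vecMulVec v₀ v₀).map Polynomial.C
        + (Polynomial.C w₁ * X ^ d₁) • (vecMulVec v₁ v₁).map Polynomial.C
        + (Polynomial.C w₂ * X ^ d₂) • (vecMulVec v₂ v₂).map Polynomial.C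
        + (Polynomial.C w₃ * X ^ d₃) • (vecMulVec v₃ v₃).map Polynomial.C))
    (by linarith) (fun x hx => by rw [hπeval]; exact pairDet_nonneg d₀ d₁ d₂ d₃ v₀ v₁ v₂ v₃ w₀ w₁ w₂ w₃ x hw₀ hw₁ hw₂ hw₃ hx) hdisc
    (fun x _ => by rw [eval_det_resolvent_form e d₀ d₁ d₂ d₃ J hJ, hτeval, hπeval]) (by rw [← hΦ]; exact hΦ0)
  rw [← hΦ] at hmain
  exact hmain

/-- **PAIR-FORM IDENTITY for the four-letter pencil (evaluated).**  With the moment polynomials of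
`rankOne_four_card_posRoots_le_one_add` and the critical polynomial `Φ` of `…PivotResolventRolle`, at every real `x`:
`Φ(x) = W(x)² + (τ(x)² + 4δπ(x))·P_e(x)`, where `P_e(x) = ∑_{k<l} (dₖ − e)(d_l − e) wₖw_l D_{kl}² x^{dₖ+d_l}` is the e-signed pair form and
`W = J₀₀(U_eC − UC_e) − J₀₁(A_eC − AC_e) + J₁₁(A_eU − AU_e)` (moments `A, U, C` and tilted moments `A_e = ∑(dₖ−e)wₖx^{dₖ}vₖ₀²`, …).
[this file] -/
theorem eval_criticalPoly_eq_sq_add (e d₀ d₁ d₂ d₃ : ℕ) (J : Matrix (Fin 2) (Fin 2) ℝ) (v₀ v₁ v₂ v₃ : Fin 2 → ℝ) (w₀ w₁ w₂ w₃ : ℝ)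
    (𝔄 𝔘 ℭ τ π Φ : ℝ[X])
    (h𝔄 : 𝔄 = Polynomial.C (w₀ * v₀ 0 ^ 2) * X ^ d₀ + Polynomial.C (w₁ * v₁ 0 ^ 2) * X ^ d₁ + Polynomial.C (w₂ * v₂ 0 ^ 2) * X ^ d₂
      + Polynomial.C (w₃ * v₃ 0 ^ 2) * X ^ d₃)
    (h𝔘 : 𝔘 = Polynomial.C (w₀ * (v₀ 0 * v₀ 1)) * X ^ d₀ + Polynomial.C (w₁ * (v₁ 0 * v₁ 1)) * X ^ d₁
      + Polynomial.C (w₂ * (v₂ 0 * v₂ 1)) * X ^ d₂ + Polynomial.C (w₃ * (v₃ 0 * v₃ 1)) * X ^ d₃)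
    (hℭ : ℭ = Polynomial.C (w₀ * v₀ 1 ^ 2) * X ^ d₀ + Polynomial.C (w₁ * v₁ 1 ^ 2) * X ^ d₁ + Polynomial.C (w₂ * v₂ 1 ^ 2) * X ^ d₂
      + Polynomial.C (w₃ * v₃ 1 ^ 2) * X ^ d₃)
    (hτ : τ = Polynomial.C (J 0 0) * ℭ - Polynomial.C (2 * J 0 1) * 𝔘 + Polynomial.C (J 1 1) * 𝔄)
    (hπ : π = 𝔄 * ℭ - 𝔘 ^ 2)
    (hΦ : Φ = Polynomial.C (J 0 1 ^ 2 - J 0 0 * J 1 1) * (X * π.derivative - Polynomial.C (2 * (e : ℝ)) * π) ^ 2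
        + τ * (X * τ.derivative - Polynomial.C (e : ℝ) * τ) * (X * π.derivative - Polynomial.C (2 * (e : ℝ)) * π)
        - π * (X * τ.derivative - Polynomial.C (e : ℝ) * τ) ^ 2) (x : ℝ) :
    Φ.eval x
      = (J 0 0 * ((((d₀ : ℝ) - e) * w₀ * x ^ d₀ * (v₀ 0 * v₀ 1) + ((d₁ : ℝ) - e) * w₁ * x ^ d₁ * (v₁ 0 * v₁ 1) + ((d₂ : ℝ) - e) * w₂ * x ^ d₂ * (v₂ 0 * v₂ 1) + ((d₃ : ℝ) - e) * w₃ * x ^ d₃ * (v₃ 0 * v₃ 1)) * (w₀ * x ^ d₀ * v₀ 1 ^ 2 + w₁ * x ^ d₁ * v₁ 1 ^ 2 + w₂ * x ^ d₂ * v₂ 1 ^ 2 + w₃ * x ^ d₃ * v₃ 1 ^ 2) - (w₀ * x ^ d₀ * (v₀ 0 * v₀ 1) + w₁ * x ^ d₁ * (v₁ 0 * v₁ 1) + w₂ * x ^ d₂ * (v₂ 0 * v₂ 1) + w₃ * x ^ d₃ * (v₃ 0 * v₃ 1)) * (((d₀ : ℝ) - e) * w₀ * x ^ d₀ * v₀ 1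 ^ 2 + ((d₁ : ℝ) - e) * w₁ * x ^ d₁ * v₁ 1 ^ 2 + ((d₂ : ℝ) - e) * w₂ * x ^ d₂ * v₂ 1 ^ 2 + ((d₃ : ℝ) - e) * w₃ * x ^ d₃ * v₃ 1 ^ 2)) - J 0 1 * ((((d₀ : ℝ) - e) * w₀ * x ^ d₀ * v₀ 0 ^ 2 + ((d₁ : ℝ) - e) * w₁ * x ^ d₁ * v₁ 0 ^ 2 + ((d₂ : ℝ) - e) * w₂ * x ^ d₂ * v₂ 0 ^ 2 + ((d₃ : ℝ) - e) * w₃ * x ^ d₃ * v₃ 0 ^ 2) * (w₀ * x ^ d₀ * v₀ 1 ^ 2 + w₁ * x ^ d₁ * v₁ 1 ^ 2 + w₂ * x ^ d₂ * v₂ 1 ^ 2 + w₃ * x ^ d₃ * v₃ 1 ^ 2) - (w₀ * x ^ d₀ * v₀ 0 ^ 2 + w₁ * x ^ d₁ * v₁ 0 ^ 2 + w₂ * x ^ d₂ * v₂ 0 ^ 2 + w₃ * x ^ d₃ * v₃ 0 ^ 2) * (((d₀ : ℝ) - e) * w₀ * x ^ d₀ * v₀ 1 ^ 2 + ((d₁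 : ℝ) - e) * w₁ * x ^ d₁ * v₁ 1 ^ 2 + ((d₂ : ℝ) - e) * w₂ * x ^ d₂ * v₂ 1 ^ 2 + ((d₃ : ℝ) - e) * w₃ * x ^ d₃ * v₃ 1 ^ 2)) + J 1 1 * ((((d₀ : ℝ) - e) * w₀ * x ^ d₀ * v₀ 0 ^ 2 + ((d₁ : ℝ) - e) * w₁ * x ^ d₁ * v₁ 0 ^ 2 + ((d₂ : ℝ) - e) * w₂ * x ^ d₂ * v₂ 0 ^ 2 + ((d₃ : ℝ) - e) * w₃ * x ^ d₃ * v₃ 0 ^ 2) * (w₀ * x ^ d₀ * (v₀ 0 * v₀ 1) + w₁ * x ^ d₁ * (v₁ 0 * v₁ 1) + w₂ * x ^ d₂ * (v₂ 0 * v₂ 1) + w₃ * x ^ d₃ * (v₃ 0 * v₃ 1)) - (w₀ * x ^ d₀ * v₀ 0 ^ 2 + w₁ * x ^ d₁ * v₁ 0 ^ 2 + w₂ * x ^ d₂ * v₂ 0 ^ 2 + w₃ * x ^ d₃ * v₃ 0 ^ 2) * (((d₀ : ℝ) - e) * w₀ * x ^ d₀ * (v₀ 0 * v₀ 1) + ((d₁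 : ℝ) - e) * w₁ * x ^ d₁ * (v₁ 0 * v₁ 1) + ((d₂ : ℝ) - e) * w₂ * x ^ d₂ * (v₂ 0 * v₂ 1) + ((d₃ : ℝ) - e) * w₃ * x ^ d₃ * (v₃ 0 * v₃ 1)))) ^ 2
        + ((τ.eval x) ^ 2 + 4 * (J 0 1 ^ 2 - J 0 0 * J 1 1) * π.eval x)
          * (((d₀ : ℝ) - e) * ((d₁ : ℝ) - e) * w₀ * w₁ * (v₀ 0 * v₁ 1 - v₀ 1 * v₁ 0) ^ 2 * x ^ (d₀ + d₁)
      + ((d₀ : ℝ) - e) * ((d₂ : ℝ) - e) * w₀ * w₂ * (v₀ 0 * v₂ 1 - v₀ 1 * v₂ 0) ^ 2 * x ^ (d₀ + d₂)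
      + ((d₀ : ℝ) - e) * ((d₃ : ℝ) - e) * w₀ * w₃ * (v₀ 0 * v₃ 1 - v₀ 1 * v₃ 0) ^ 2 * x ^ (d₀ + d₃)
      + ((d₁ : ℝ) - e) * ((d₂ : ℝ) - e) * w₁ * w₂ * (v₁ 0 * v₂ 1 - v₁ 1 * v₂ 0) ^ 2 * x ^ (d₁ + d₂)
      + ((d₁ : ℝ) - e) * ((d₃ : ℝ) - e) * w₁ * w₃ * (v₁ 0 * v₃ 1 - v₁ 1 * v₃ 0) ^ 2 * x ^ (d₁ + d₃)
      + ((d₂ : ℝ) - e) * ((d₃ : ℝ) - e) * w₂ * w₃ * (v₂ 0 * v₃ 1 - v₂ 1 * v₃ 0) ^ 2 * x ^ (d₂ + d₃)) := by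
  have dA : x * 𝔄.derivative.eval x - e * 𝔄.eval x = (((d₀ : ℝ) - e) * w₀ * x ^ d₀ * v₀ 0 ^ 2 + ((d₁ : ℝ) - e) * w₁ * x ^ d₁ * v₁ 0 ^ 2 + ((d₂ : ℝ) - e) * w₂ * x ^ d₂ * v₂ 0 ^ 2 + ((d₃ : ℝ) - e) * w₃ * x ^ d₃ * v₃ 0 ^ 2) := by
    rw [h𝔄, x_mul_eval_derivative_fourNomial, eval_fourNomial]; ring
  have dU : x * 𝔘.derivative.eval x - e * 𝔘.eval x = (((d₀ : ℝ) - e) * w₀ * x ^ d₀ * (v₀ 0 * v₀ 1) + ((d₁ : ℝ) - e) * w₁ * x ^ d₁ * (v₁ 0 * v₁ 1) + ((d₂ : ℝ) - e) * w₂ * x ^ d₂ * (v₂ 0 * v₂ 1) + ((d₃ : ℝ) - e) * w₃ * x ^ d₃ * (v₃ 0 * v₃ 1)) := by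
    rw [h𝔘, x_mul_eval_derivative_fourNomial, eval_fourNomial]; ring
  have dC : x * ℭ.derivative.eval x - e * ℭ.eval x = (((d₀ : ℝ) - e) * w₀ * x ^ d₀ * v₀ 1 ^ 2 + ((d₁ : ℝ) - e) * w₁ * x ^ d₁ * v₁ 1 ^ 2 + ((d₂ : ℝ) - e) * w₂ * x ^ d₂ * v₂ 1 ^ 2 + ((d₃ : ℝ) - e) * w₃ * x ^ d₃ * v₃ 1 ^ 2) := by
    rw [hℭ, x_mul_eval_derivative_fourNomial, eval_fourNomial]; ring
  have eA : 𝔄.eval x = (w₀ * x ^ d₀ * v₀ 0 ^ 2 + w₁ * x ^ d₁ * v₁ 0 ^ 2 + w₂ * x ^ d₂ * v₂ 0 ^ 2 + w₃ * x ^ d₃ * v₃ 0 ^ 2) := by rw [h𝔄, eval_fourNomial]; ring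
  have eU : 𝔘.eval x = (w₀ * x ^ d₀ * (v₀ 0 * v₀ 1) + w₁ * x ^ d₁ * (v₁ 0 * v₁ 1) + w₂ * x ^ d₂ * (v₂ 0 * v₂ 1) + w₃ * x ^ d₃ * (v₃ 0 * v₃ 1)) := by rw [h𝔘, eval_fourNomial]; ring
  have eC : ℭ.eval x = (w₀ * x ^ d₀ * v₀ 1 ^ 2 + w₁ * x ^ d₁ * v₁ 1 ^ 2 + w₂ * x ^ d₂ * v₂ 1 ^ 2 + w₃ * x ^ d₃ * v₃ 1 ^ 2) := by rw [hℭ, eval_fourNomial]; ring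
  rw [eval_criticalPoly_eq e J 𝔄 𝔘 ℭ τ π Φ hτ hπ hΦ x, dA, dU, dC, eA, eU, eC, ← pairForm_eq]

/-- **Critical points live in `{P_e ≤ 0}`.**  In the setting of `eval_criticalPoly_eq_sq_add`: at every real `x` where `Φ(x) = 0` and the
resolvent discriminant `τ(x)² + 4δπ(x)` is positive, the e-signed pair form is non-positive:
`∑_{k<l} (dₖ − e)(d_l − e) wₖw_l D_{kl}² x^{dₖ+d_l} ≤ 0`.  (By `…PivotResolventRolle.resolvent_critical`, every critical point of the
resolvent profile `R(x)/x^e` on `(0, ∞)` is such a root.) [this file] -/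
theorem pairForm_nonpos_of_isRoot (e d₀ d₁ d₂ d₃ : ℕ) (J : Matrix (Fin 2) (Fin 2) ℝ) (v₀ v₁ v₂ v₃ : Fin 2 → ℝ) (w₀ w₁ w₂ w₃ : ℝ)
    (𝔄 𝔘 ℭ τ π Φ : ℝ[X])
    (h𝔄 : 𝔄 = Polynomial.C (w₀ * v₀ 0 ^ 2) * X ^ d₀ + Polynomial.C (w₁ * v₁ 0 ^ 2) * X ^ d₁ + Polynomial.C (w₂ * v₂ 0 ^ 2) * X ^ d₂
      + Polynomial.C (w₃ * v₃ 0 ^ 2) * X ^ d₃)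
    (h𝔘 : 𝔘 = Polynomial.C (w₀ * (v₀ 0 * v₀ 1)) * X ^ d₀ + Polynomial.C (w₁ * (v₁ 0 * v₁ 1)) * X ^ d₁
      + Polynomial.C (w₂ * (v₂ 0 * v₂ 1)) * X ^ d₂ + Polynomial.C (w₃ * (v₃ 0 * v₃ 1)) * X ^ d₃)
    (hℭ : ℭ = Polynomial.C (w₀ * v₀ 1 ^ 2) * X ^ d₀ + Polynomial.C (w₁ * v₁ 1 ^ 2) * X ^ d₁ + Polynomial.C (w₂ * v₂ 1 ^ 2) * X ^ d₂
      + Polynomial.C (w₃ * v₃ 1 ^ 2) * X ^ d₃)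
    (hτ : τ = Polynomial.C (J 0 0) * ℭ - Polynomial.C (2 * J 0 1) * 𝔘 + Polynomial.C (J 1 1) * 𝔄)
    (hπ : π = 𝔄 * ℭ - 𝔘 ^ 2)
    (hΦ : Φ = Polynomial.C (J 0 1 ^ 2 - J 0 0 * J 1 1) * (X * π.derivative - Polynomial.C (2 * (e : ℝ)) * π) ^ 2
        + τ * (X * τ.derivative - Polynomial.C (e : ℝ) * τ) * (X * π.derivative - Polynomial.C (2 * (e : ℝ)) * π)
        - π * (X * τ.derivative - Polynomial.C (e : ℝ) * τ) ^ 2)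
    (x : ℝ) (hroot : Φ.IsRoot x) (hdisc : 0 < (τ.eval x) ^ 2 + 4 * (J 0 1 ^ 2 - J 0 0 * J 1 1) * π.eval x) :
    (((d₀ : ℝ) - e) * ((d₁ : ℝ) - e) * w₀ * w₁ * (v₀ 0 * v₁ 1 - v₀ 1 * v₁ 0) ^ 2 * x ^ (d₀ + d₁)
      + ((d₀ : ℝ) - e) * ((d₂ : ℝ) - e) * w₀ * w₂ * (v₀ 0 * v₂ 1 - v₀ 1 * v₂ 0) ^ 2 * x ^ (d₀ + d₂)
      + ((d₀ : ℝ) - e) * ((d₃ : ℝ) - e) * w₀ * w₃ * (v₀ 0 * v₃ 1 - v₀ 1 * v₃ 0) ^ 2 * x ^ (d₀ + d₃)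
      + ((d₁ : ℝ) - e) * ((d₂ : ℝ) - e) * w₁ * w₂ * (v₁ 0 * v₂ 1 - v₁ 1 * v₂ 0) ^ 2 * x ^ (d₁ + d₂)
      + ((d₁ : ℝ) - e) * ((d₃ : ℝ) - e) * w₁ * w₃ * (v₁ 0 * v₃ 1 - v₁ 1 * v₃ 0) ^ 2 * x ^ (d₁ + d₃)
      + ((d₂ : ℝ) - e) * ((d₃ : ℝ) - e) * w₂ * w₃ * (v₂ 0 * v₃ 1 - v₂ 1 * v₃ 0) ^ 2 * x ^ (d₂ + d₃)) ≤ 0 := by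
  have key := eval_criticalPoly_eq_sq_add e d₀ d₁ d₂ d₃ J v₀ v₁ v₂ v₃ w₀ w₁ w₂ w₃ 𝔄 𝔘 ℭ τ π Φ h𝔄 h𝔘 hℭ hτ hπ hΦ x
  rw [IsRoot.def] at hroot
  rw [hroot] at key
  set Wx := (J 0 0 * ((((d₀ : ℝ) - e) * w₀ * x ^ d₀ * (v₀ 0 * v₀ 1) + ((d₁ : ℝ) - e) * w₁ * x ^ d₁ * (v₁ 0 * v₁ 1) + ((d₂ : ℝ) - e) * w₂ * x ^ d₂ * (v₂ 0 * v₂ 1) + ((d₃ : ℝ) - e) * w₃ * x ^ d₃ * (v₃ 0 * v₃ 1)) * (w₀ * x ^ d₀ * v₀ 1 ^ 2 + w₁ * x ^ d₁ * v₁ 1 ^ 2 + w₂ * x ^ d₂ * v₂ 1 ^ 2 + w₃ * x ^ d₃ * v₃ 1 ^ 2) - (w₀ * x ^ d₀ * (v₀ 0 * v₀ 1) + w₁ * x ^ d₁ * (v₁ 0 * v₁ 1) + w₂ * x ^ d₂ * (v₂ 0 * v₂ 1) + w₃ * x ^ d₃ * (v₃ 0 * v₃ 1)) * (((d₀ : ℝ)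 - e) * w₀ * x ^ d₀ * v₀ 1 ^ 2 + ((d₁ : ℝ) - e) * w₁ * x ^ d₁ * v₁ 1 ^ 2 + ((d₂ : ℝ) - e) * w₂ * x ^ d₂ * v₂ 1 ^ 2 + ((d₃ : ℝ) - e) * w₃ * x ^ d₃ * v₃ 1 ^ 2)) - J 0 1 * ((((d₀ : ℝ) - e) * w₀ * x ^ d₀ * v₀ 0 ^ 2 + ((d₁ : ℝ) - e) * w₁ * x ^ d₁ * v₁ 0 ^ 2 + ((d₂ : ℝ) - e) * w₂ * x ^ d₂ * v₂ 0 ^ 2 + ((d₃ : ℝ) - e) * w₃ * x ^ d₃ * v₃ 0 ^ 2) * (w₀ * x ^ d₀ * v₀ 1 ^ 2 + w₁ * x ^ d₁ * v₁ 1 ^ 2 + w₂ * x ^ d₂ * v₂ 1 ^ 2 + w₃ * x ^ d₃ * v₃ 1 ^ 2) - (w₀ * x ^ d₀ * v₀ 0 ^ 2 + w₁ * x ^ d₁ * v₁ 0 ^ 2 + w₂ * x ^ d₂ * v₂ 0 ^ 2 + w₃ * x ^ d₃ * v₃ 0 ^ 2) * (((d₀ : ℝ) - e) * w₀ * x ^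 d₀ * v₀ 1 ^ 2 + ((d₁ : ℝ) - e) * w₁ * x ^ d₁ * v₁ 1 ^ 2 + ((d₂ : ℝ) - e) * w₂ * x ^ d₂ * v₂ 1 ^ 2 + ((d₃ : ℝ) - e) * w₃ * x ^ d₃ * v₃ 1 ^ 2)) + J 1 1 * ((((d₀ : ℝ) - e) * w₀ * x ^ d₀ * v₀ 0 ^ 2 + ((d₁ : ℝ) - e) * w₁ * x ^ d₁ * v₁ 0 ^ 2 + ((d₂ : ℝ) - e) * w₂ * x ^ d₂ * v₂ 0 ^ 2 + ((d₃ : ℝ) - e) * w₃ * x ^ d₃ * v₃ 0 ^ 2) * (w₀ * x ^ d₀ * (v₀ 0 * v₀ 1) + w₁ * x ^ d₁ * (v₁ 0 * v₁ 1) + w₂ * x ^ d₂ * (v₂ 0 * v₂ 1) + w₃ * x ^ d₃ * (v₃ 0 * v₃ 1)) - (w₀ * x ^ d₀ * v₀ 0 ^ 2 + w₁ * x ^ d₁ * v₁ 0 ^ 2 + w₂ * x ^ d₂ * v₂ 0 ^ 2 + w₃ * x ^ d₃ * v₃ 0 ^ 2) * (((d₀ : ℝ) - e) * w₀ * x ^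 d₀ * (v₀ 0 * v₀ 1) + ((d₁ : ℝ) - e) * w₁ * x ^ d₁ * (v₁ 0 * v₁ 1) + ((d₂ : ℝ) - e) * w₂ * x ^ d₂ * (v₂ 0 * v₂ 1) + ((d₃ : ℝ) - e) * w₃ * x ^ d₃ * (v₃ 0 * v₃ 1)))) with hWx
  set S2 := (τ.eval x) ^ 2 + 4 * (J 0 1 ^ 2 - J 0 0 * J 1 1) * π.eval x with hS2
  by_contra hP
  push Not at hP
  have h1 : 0 ≤ Wx ^ 2 := sq_nonneg Wx
  have h2 := mul_pos hdisc hP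
  linarith

end Summit.ValiantsHypothesis.ValiantsHypothesis.Theorems.LacunarySymmetroidMatrixDescartes.Pivot.Resolvent
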